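import Summits.QuantumFields.BalabanUV.Beta.FP.ScalarPropagatorProjection
import Literature.MathematicalPhysics.QuantumFieldTheory.Balaban1983to89.B5G0BridgeP12
import Literature.MathematicalPhysics.QuantumFieldTheory.Balaban1983to89.B5Display136Torus

/-!
# `BalabanUV.Beta.FP.ScalarTowerBridge` — road «FP» (binder row D1), lane IR-5′, **THE (T0′) SUPPLIER CHAIN, FILE 6: b05's MASSIVE SCALAR
# PROPAGATOR `G′ = (Δ + bQ′*Q′)⁻¹` ON THE TORUS `Tor (fine (L^K) (2L^m))` IS lit-balaban's TOWER PROPAGATOR `(tower P a 0).G K`** (`b = a_K`, B1 (2.13)),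
# read through r02's site bridge `B5SiteBridgeP12.eFine`∕`eUnit` — the scalar operator dictionary `Δ ↔ hOp`, `Q′ ↔ Qk`, `Q′* ↔ Qks`, `∂ ↔ deriv`
# (index bookkeeping over r02's `B5G0BridgeP12`; nothing analytic)

HONEST DEPENDENCY (page 1, mandatory): continuum YM on T⁴ ⇐ BetaPertH ∧ nine spine estimates (0/9 proved); BetaPertH ⇐ (D1) ∧ (D4) ∧
CAP+tail; G-an2-4 gates asym, D1 and NE2/3/4.  HONEST FRAMING (cell contract, verbatim): «discharging `BetaPertH` makes Bałaban's UV
stability UNCONDITIONAL — a real constructive-QFT result; it is NOT the continuum limit and NOT the Clay problem.»  THIS MODULE is index bookkeeping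
BY NAME over: r02's `B5SiteBridgeP12` (`eFine : Site P 0 ≃ Tor (fine n M)`, `eUnit : Site P K ≃ Tor M`, `n = L^K`, `M_μ = 2L^m`) and `B5G0BridgeP12`
(`eFine_shift`, `embA_Lap`, `proj_eq_iff`, `eps_inv`, `Lpow_d_lvl_eq`, `eUnit_blk`), p37∕pv07's `B1RG242Torus` (`tower`, `hOp`, `deriv`, `Qk`, `Qks`, `G_arg`),
`B5Display136Torus.Grs`, b05's `B5Action121`∕`B5Block118`∕`B5Hk160Torus`∕`B5Adjoint130`, `Beta.VectorPropagatorDict.Lap_mulVec_apply`, and file 4a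
(`isUnit_DeltaP`).  It cites nothing as a hypothesis, mints no `Prop`, has no `def`, 0 sorry; nothing analytic.  NOT (T0′), NOT hslice, NOT (ASYMP), NOT D1,
NOT BetaPertH, NOT continuum, NOT Clay.

ABSOLUTE RULE (cell charter, verbatim): «No internally-minted statement may enter as a cited fact. Every hypothesis is either kernel-proved in this
package or a verbatim quotation of a PUBLISHED theorem with page reference. The manuscript(s) under audit are NOT citable for their own disputed
steps — they are the thing under adjudication; programme-internal (2001/route/tribunal) claims are never citable.»

WHY.  After files 4a∕4b∕5 the row-sum letter of the hard covariance `𝒞` rests on three first-order letters of the massive SCALAR `G′` on b05's torus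
(`‖G′‖`, `‖∂G′‖`, `‖G′∂ᴴ‖`, `ℓ^∞ → ℓ^∞`).  Their suppliers are lit-balaban's B4-Theorem-(1.10)-on-the-torus statements for Bałaban's concrete scalar
tower (`B4Thm110ZeroTorus.thm110_zero_torus`, `B5Ineq110GpTorus.sup_GrsDstar_torus`), typed on `Site P 0`.  This file identifies the OPERATORS: for
every tower volume `P` (`n = nP P = L^K`, `M = MP P`), `Δ + a_K·Q′*Q′` on `Tor (fine n M)` IS `H + α_K·Q*_KQ_K` on `Site P 0` along `eFine`
(`a_K = B1.aSeq a L K ∈ [a(1 − L⁻²), a]`, the running constant of B1 (2.13); B5 p. 26 «we can take arbitrary a in the representation»), hence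
`G′ = (tower P a 0).G K = B5Display136Torus.Grs P a 0 K` entrywise, and `∂ = deriv`; file 7 reads the three letters off the tower theorems.

CONTENT (`P : Params` of `Setup`, `n = nP P`, `M = MP P`, `e = eFine P`, `u = eUnit P`).  §1 `LapS_mulVec_bridge` (`Δ(f∘e⁻¹) = (hOp·f)∘e⁻¹`, from r02's
`embA_Lap` + `Lap_mulVec_apply`), **`LapS_bridge`** (entries); §2 **`QsOp_bridge`**, **`QsAdj_bridge`**, **`QsAdj_mul_QsOp_bridge`** (`Q′*Q′(e x, e x′) = (Q*_KQ_K)(x, x′)`);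
§3 **`DeltaP_bridge`**, **`DeltaP_eq_submatrix`** (`Δ + a_K·Q′*Q′ = ((H + α_K·Q*_KQ_K).map ofReal).submatrix e⁻¹ e⁻¹`), `aSeq_lower` (`a(1 − L⁻²) ≤ a_K`),
`towerG_eq_inv`, `Grs_top_eq_towerG`, **`Gp_eq_submatrix_towerG`**, **`Gp_bridge`** (`G′(e x, e x′) = G_K(x, x′)`); §4 **`GradOp_bridge`**
(`∂((e x, μ), e x′) = deriv_μ(x, x′)`), **`GradOp_Gp_bridge`**, **`Gp_GradOpH_bridge`** (`(∂G′)((e x, μ), e x′) = (deriv_μ·G_K)(x, x′)`,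
`(G′∂ᴴ)(e x, (e x′, ν)) = (G_K·deriv_νᵀ)(x, x′)`).
Unit `b2b-balaban-beta-d1-formalise-leaf-05` (gen 19), 2026-08-21; `LEAVES-FP.md` row «(T0′) CHAIN FILE 6».  «not in print; our bookkeeping».
-/

noncomputable section

open scoped BigOperators Matrix ComplexConjugate

namespace Summit.QuantumFields.BalabanUV.Beta.FP.ScalarTowerBridge

open Literature.MathematicalPhysics.QuantumFieldTheory.Balaban1983to89
open Literature.MathematicalPhysics.QuantumFieldTheory.Balaban1983to89.B5Prop11Plancherel (Tor fine unitVec)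
open Literature.MathematicalPhysics.QuantumFieldTheory.Balaban1983to89.B5Action121 (GradOp LapS sdiff shiftS comp)
open Literature.MathematicalPhysics.QuantumFieldTheory.Balaban1983to89.B5Block118 (QsOp bpt)
open Literature.MathematicalPhysics.QuantumFieldTheory.Balaban1983to89.B5Adjoint130 (QsOp_apply)
open Literature.MathematicalPhysics.QuantumFieldTheory.Balaban1983to89.B5Hk160Torus (QsAdj)
open Literature.MathematicalPhysics.QuantumFieldTheory.Balaban1983to89.Beta.VectorPropagatorDict (Lap_mulVec_apply)
open Literature.MathematicalPhysics.QuantumFieldTheory.Balaban1983to89.B5SiteBridgeP12 (nP MP eFine eUnit eFine_val eUnit_blk one_le_nP)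
open Literature.MathematicalPhysics.QuantumFieldTheory.Balaban1983to89.B5G0BridgeP12 (eFine_shift embA embA_apply embA_Lap proj_eq_iff proj_K_eq_blk
  eps_inv Lpow_K_eq Lpow_d_lvl_eq)
open Literature.MathematicalPhysics.QuantumFieldTheory.Balaban1983to89.B1RG242Torus (shiftMat deriv hOp H Qk Qks α avgMat extMat tower lvl lvl_of_le
  G_arg)
open Literature.MathematicalPhysics.QuantumFieldTheory.Balaban1983to89.B5Display136Torus (Grs)
open Summit.QuantumFields.BalabanUV.Beta.FP.ScalarPropagatorProjection (isUnit_DeltaP)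

variable (P : Params)

/-! ## §1 The scalar Laplacian: `Δ ↔ hOp P 0 ε 0` -/

/-- [our bookkeeping] **`Δ(f ∘ e⁻¹) = (hOp·f) ∘ e⁻¹`** for real `f` — r02's vector statement `embA_Lap` read on one component
(`Lap_mulVec_apply`: the vector `Δ` acts componentwise as `LapS`). -/
theorem LapS_mulVec_bridge (f : Site P 0 → ℝ) :
    LapS (fine (nP P) (MP P)) (nP P : ℂ) *ᵥ (fun z => (f ((eFine P).symm z) : ℂ))
      = fun z => ((hOp P 0 P.eps 0 *ᵥ f) ((eFine P).symm z) : ℂ) := by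
  have hκ : 0 < P.d := P.hd
  set κ : Fin P.d := ⟨0, hκ⟩
  have hcomp : comp (fine (nP P) (MP P)) (embA P fun _ => f) κ = fun z => (f ((eFine P).symm z) : ℂ) := by
    funext z; rfl
  funext z
  have h := congrFun (embA_Lap P fun _ => f) (z, κ)
  rw [Lap_mulVec_apply, hcomp, embA_apply] at h
  exact h

/-- [folklore] a complex basis vector on the torus is the bridged real basis vector. -/
theorem single_bridge (x' : Site P 0) :
    (Pi.single (eFine P x') (1 : ℂ) : Tor (fine (nP P) (MP P)) → ℂ) = fun z => ((Pi.single x' (1 : ℝ) : Site P 0 → ℝ) ((eFine P).symm z) : ℂ) := by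
  funext z
  by_cases h : z = eFine P x'
  · subst h; simp
  · have h' : (eFine P).symm z ≠ x' := fun h'' => h (by rw [← h'', Equiv.apply_symm_apply])
    rw [Pi.single_eq_of_ne h, Pi.single_eq_of_ne h', Complex.ofReal_zero]

/-- [our bookkeeping] **THE LAPLACIAN ENTRIES AGREE**: `Δ(e x, e x′) = hOp(x, x′)`. -/
theorem LapS_bridge (x x' : Site P 0) :
    LapS (fine (nP P) (MP P)) (nP P : ℂ) (eFine P x) (eFine P x') = ((hOp P 0 P.eps 0) x x' : ℂ) := by
  have h1 : LapS (fine (nP P) (MP P)) (nP P : ℂ) *ᵥ (Pi.single (eFine P x') (1 : ℂ))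
      = fun z => ((hOp P 0 P.eps 0 *ᵥ (Pi.single x' (1 : ℝ))) ((eFine P).symm z) : ℂ) := by
    rw [single_bridge]
    exact LapS_mulVec_bridge P _
  have h2 := congrFun h1 (eFine P x)
  simp only [Matrix.mulVec_single_one, Matrix.col_apply, Equiv.symm_apply_apply] at h2
  exact h2

/-! ## §2 The block average and its adjoint: `Q′ ↔ Q_K`, `Q′* ↔ Q*_K` -/

/-- [folklore] `blockOf (e x) = u (proj_K x)`. -/
theorem blockOf_eFine (x : Site P 0) : B5Blocks16.blockOf (nP P) (MP P) (eFine P x) = eUnit P (Site.proj P.K P.K x) := by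
  rw [proj_K_eq_blk, eUnit_blk]

/-- [our bookkeeping] **`Q′(u y, e x) = Q_K(y, x)`** (`n^{−d}·[x ∈ B^K(y)]` on both sides). -/
theorem QsOp_bridge (y : Site P P.K) (x : Site P 0) :
    QsOp (nP P) (MP P) (eUnit P y) (eFine P x) = ((Qk P P.K) y x : ℂ) := by
  have hl : lvl P P.K = P.K := lvl_of_le P (Nat.le_add_left P.K P.m)
  have hw : ((((P.L : ℝ) ^ P.d)⁻¹) ^ P.K) = (((nP P : ℝ) ^ P.d))⁻¹ := by
    rw [inv_pow, ← pow_mul, mul_comm, pow_mul, Lpow_K_eq]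
  rw [QsOp_apply, blockOf_eFine]
  simp only [Qk, avgMat, hl]
  by_cases h : Site.proj P.K P.K x = y
  · rw [if_pos (by rw [h]), if_pos h, hw]
    push_cast
    rw [one_div]
  · rw [if_neg (fun h' => h ((eUnit P).injective h')), if_neg h]
    push_cast
    rfl

/-- [our bookkeeping] **`Q′*(e x, u y) = Q*_K(x, y)`** (the indicator of `x ∈ B^K(y)` on both sides). -/
theorem QsAdj_bridge (x : Site P 0) (y : Site P P.K) :
    QsAdj (nP P) (MP P) (eFine P x) (eUnit P y) = ((Qks P P.K) x y : ℂ) := by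
  have hl : lvl P P.K = P.K := lvl_of_le P (Nat.le_add_left P.K P.m)
  have hc : ((nP P : ℂ) ^ P.d) ≠ 0 := pow_ne_zero _ (Nat.cast_ne_zero.mpr (NeZero.ne (nP P)))
  have hw : ((((P.L : ℝ) ^ P.d)⁻¹) ^ P.K) = (((nP P : ℝ) ^ P.d))⁻¹ := by
    rw [inv_pow, ← pow_mul, mul_comm, pow_mul, Lpow_K_eq]
  rw [QsAdj, Matrix.smul_apply, Matrix.conjTranspose_apply, QsOp_bridge, Complex.star_def, Complex.conj_ofReal, smul_eq_mul]
  simp only [Qk, Qks, avgMat, extMat, hl]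
  by_cases h : Site.proj P.K P.K x = y
  · rw [if_pos h, if_pos h, hw]
    push_cast
    rw [mul_inv_cancel₀ hc]
  · rw [if_neg h, if_neg h]
    push_cast
    rw [mul_zero]

/-- [our bookkeeping] **`Q′*Q′(e x, e x′) = (Q*_KQ_K)(x, x′)`** (sum over the unit torus re-indexed by `eUnit`). -/
theorem QsAdj_mul_QsOp_bridge (x x' : Site P 0) :
    (QsAdj (nP P) (MP P) * QsOp (nP P) (MP P)) (eFine P x) (eFine P x') = ((Qks P P.K * Qk P P.K) x x' : ℂ) := by
  rw [Matrix.mul_apply, Matrix.mul_apply, ← (eUnit P).sum_comp]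
  push_cast
  exact Finset.sum_congr rfl fun y _ => by rw [QsAdj_bridge, QsOp_bridge]

/-! ## §3 `Δ + a_KQ′*Q′ ↔ H + α_KQ*_KQ_K`, and the propagators -/

/-- [our bookkeeping] **THE MASSIVE SCALAR OPERATORS AGREE ENTRYWISE**: `(Δ + a_K·Q′*Q′)(e x, e x′) = (H + α_K·Q*_KQ_K)(x, x′)`,
`a_K = α P a K = B1.aSeq a L K` (`spacing K = 1`). -/
theorem DeltaP_bridge (a : ℝ) (x x' : Site P 0) :
    (LapS (fine (nP P) (MP P)) (nP P : ℂ) + ((α P a P.K : ℝ) : ℂ) • (QsAdj (nP P) (MP P) * QsOp (nP P) (MP P))) (eFine P x) (eFine P x')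
      = ((H P 0 + α P a P.K • (Qks P P.K * Qk P P.K)) x x' : ℂ) := by
  rw [Matrix.add_apply, Matrix.smul_apply, Matrix.add_apply, Matrix.smul_apply, LapS_bridge, QsAdj_mul_QsOp_bridge, smul_eq_mul, smul_eq_mul]
  push_cast
  rfl

/-- [our bookkeeping] **MATRIX FORM**: `Δ + a_K·Q′*Q′ = ((H + α_K·Q*_KQ_K).map ofReal).submatrix e⁻¹ e⁻¹`. -/
theorem DeltaP_eq_submatrix (a : ℝ) :
    LapS (fine (nP P) (MP P)) (nP P : ℂ) + ((α P a P.K : ℝ) : ℂ) • (QsAdj (nP P) (MP P) * QsOp (nP P) (MP P))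
      = ((H P 0 + α P a P.K • (Qks P P.K * Qk P P.K)).map Complex.ofRealHom).submatrix (eFine P).symm (eFine P).symm := by
  ext z z'
  obtain ⟨x, rfl⟩ : ∃ x, eFine P x = z := ⟨(eFine P).symm z, (eFine P).apply_symm_apply z⟩
  obtain ⟨x', rfl⟩ : ∃ x', eFine P x' = z' := ⟨(eFine P).symm z', (eFine P).apply_symm_apply z'⟩
  rw [DeltaP_bridge, Matrix.submatrix_apply, Matrix.map_apply, Equiv.symm_apply_apply, Equiv.symm_apply_apply, Complex.ofRealHom_eq_coe]

/-- [folklore] `α P a K = a_K := B1.aSeq a L K` (`spacing K = 1`). -/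
theorem α_top (a : ℝ) : α P a P.K = B1.aSeq a P.L P.K := by
  rw [α, P.spacing_K, one_pow, inv_one, mul_one]

/-- [folklore] **the running constant stays in a compact range**: `a(1 − L⁻²) ≤ a_K ≤ a` for `K ≥ 1` (B1 (2.13)∕(2.15)). -/
theorem aSeq_bounds {a : ℝ} (ha : 0 < a) {K : ℕ} (hK : 1 ≤ K) :
    a * (1 - ((P.L : ℝ) ^ 2)⁻¹) ≤ B1.aSeq a P.L K ∧ B1.aSeq a P.L K ≤ a := by
  have hL : (1 : ℝ) < P.L := by exact_mod_cast P.hL.2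
  refine ⟨?_, B1.aSeq_le ha hL K hK⟩
  have hr0 : 0 < ((P.L : ℝ) ^ 2)⁻¹ := by positivity
  have hr1 : ((P.L : ℝ) ^ 2)⁻¹ < 1 := inv_lt_one_of_one_lt₀ (by nlinarith)
  have hden : 0 < 1 - (((P.L : ℝ) ^ 2)⁻¹) ^ K := by
    have : (((P.L : ℝ) ^ 2)⁻¹) ^ K < 1 := pow_lt_one₀ hr0.le hr1 (by omega)
    linarith
  have hden1 : 1 - (((P.L : ℝ) ^ 2)⁻¹) ^ K ≤ 1 := by
    have : 0 ≤ (((P.L : ℝ) ^ 2)⁻¹) ^ K := pow_nonneg hr0.le K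
    linarith
  rw [B1.aSeq_eq]
  have hnum : 0 ≤ a * (1 - ((P.L : ℝ) ^ 2)⁻¹) := mul_nonneg ha.le (by linarith)
  exact (le_div_iff₀ hden).mpr (by nlinarith)

/-- [folklore] `0 < a_K`. -/
theorem aSeq_top_pos {a : ℝ} (ha : 0 < a) (hK : 1 ≤ P.K) : 0 < B1.aSeq a P.L P.K :=
  B1.aSeq_pos ha (by exact_mod_cast P.hL.2) hK

/-- [folklore] the tower propagator at the top is the inverse of `H + α_K·Q*_KQ_K` (unfolding `B1RG242.Tower.G`). -/
theorem towerG_eq_inv (a msq : ℝ) :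
    (tower P a msq).G P.K = (H P msq + α P a P.K • (Qks P P.K * Qk P P.K))⁻¹ := rfl

/-- [folklore] `B5Display136Torus.Grs P a 0 K` (the rescaled `G_K^{resc}`, `spacing K = 1`) is the same inverse. -/
theorem Grs_top_eq_towerG (a : ℝ) : Grs P a 0 P.K = (tower P a 0).G P.K := by
  rw [Grs, towerG_eq_inv, H, P.spacing_K, div_one, one_pow, one_mul, α_top]

/-- [our bookkeeping] **`G′ = G_K`**: b05's `(Δ + a_K·Q′*Q′)⁻¹` on `Tor (fine n M)` is the transported tower propagator (`a > 0`, `K ≥ 1`;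
`B1RG242Torus.G_arg` + uniqueness of the inverse). -/
theorem Gp_eq_submatrix_towerG {a : ℝ} (ha : 0 < a) (hK : 1 ≤ P.K) :
    (LapS (fine (nP P) (MP P)) (nP P : ℂ) + ((α P a P.K : ℝ) : ℂ) • (QsAdj (nP P) (MP P) * QsOp (nP P) (MP P)))⁻¹
      = (((tower P a 0).G P.K).map Complex.ofRealHom).submatrix (eFine P).symm (eFine P).symm := by
  have hU := G_arg P ha le_rfl P.K hK
  refine Matrix.inv_eq_left_inv ?_
  rw [DeltaP_eq_submatrix, Matrix.submatrix_mul_equiv, ← Matrix.map_mul, towerG_eq_inv,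
    Matrix.nonsing_inv_mul _ ((Matrix.isUnit_iff_isUnit_det _).mp hU), Matrix.map_one Complex.ofRealHom (map_zero _) (map_one _),
    Matrix.submatrix_one_equiv]

/-- [our bookkeeping] **ENTRY FORM**: `G′(e x, e x′) = G_K(x, x′)`. -/
theorem Gp_bridge {a : ℝ} (ha : 0 < a) (hK : 1 ≤ P.K) (x x' : Site P 0) :
    (LapS (fine (nP P) (MP P)) (nP P : ℂ) + ((α P a P.K : ℝ) : ℂ) • (QsAdj (nP P) (MP P) * QsOp (nP P) (MP P)))⁻¹ (eFine P x) (eFine P x')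
      = (((tower P a 0).G P.K) x x' : ℂ) := by
  rw [Gp_eq_submatrix_towerG P ha hK, Matrix.submatrix_apply, Matrix.map_apply, Equiv.symm_apply_apply, Equiv.symm_apply_apply,
    Complex.ofRealHom_eq_coe]

/-! ## §4 The gradient: `∂ ↔ deriv`, and the two gradient kernels of `G′` -/

/-- [our bookkeeping] **`∂((e x, μ), e x′) = deriv_μ(x, x′)`** (`n·([x′ = x + e_μ] − [x′ = x])` on both sides, `n = ε⁻¹`). -/
theorem GradOp_bridge (x x' : Site P 0) (μ : Fin P.d) :
    GradOp (fine (nP P) (MP P)) (nP P : ℂ) (eFine P x, μ) (eFine P x') = ((deriv P 0 P.eps μ) x x' : ℂ) := by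
  have he : (eFine P x' = eFine P x + unitVec (fine (nP P) (MP P)) μ) ↔ (x' = Site.shift x μ) := by
    rw [← eFine_shift, (eFine P).injective.eq_iff]
  simp only [B5Action121.GradOp, B5Action121.sdiff, B1RG242Torus.deriv, B5Action121.shiftS, B1RG242Torus.shiftMat, Matrix.smul_apply,
    Matrix.sub_apply, Matrix.one_apply, smul_eq_mul, (eFine P).injective.eq_iff, he, eps_inv]
  push_cast
  split_ifs <;> norm_num

/-- [our bookkeeping] **`(∂·G′)((e x, μ), e x′) = (deriv_μ·G_K)(x, x′)`**. -/
theorem GradOp_Gp_bridge {a : ℝ} (ha : 0 < a) (hK : 1 ≤ P.K) (x x' : Site P 0) (μ : Fin P.d) :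
    (GradOp (fine (nP P) (MP P)) (nP P : ℂ)
        * (LapS (fine (nP P) (MP P)) (nP P : ℂ) + ((α P a P.K : ℝ) : ℂ) • (QsAdj (nP P) (MP P) * QsOp (nP P) (MP P)))⁻¹) (eFine P x, μ) (eFine P x')
      = ((deriv P 0 P.eps μ * (tower P a 0).G P.K) x x' : ℂ) := by
  rw [Matrix.mul_apply, Matrix.mul_apply, ← (eFine P).sum_comp]
  push_cast
  exact Finset.sum_congr rfl fun x'' _ => by rw [GradOp_bridge, Gp_bridge P ha hK]

/-- [our bookkeeping] **`(G′·∂ᴴ)(e x, (e x′, ν)) = (G_K·deriv_νᵀ)(x, x′)`** (`∂` has real entries, so `∂ᴴ = ∂ᵀ`). -/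
theorem Gp_GradOpH_bridge {a : ℝ} (ha : 0 < a) (hK : 1 ≤ P.K) (x x' : Site P 0) (ν : Fin P.d) :
    ((LapS (fine (nP P) (MP P)) (nP P : ℂ) + ((α P a P.K : ℝ) : ℂ) • (QsAdj (nP P) (MP P) * QsOp (nP P) (MP P)))⁻¹
        * (GradOp (fine (nP P) (MP P)) (nP P : ℂ))ᴴ) (eFine P x) (eFine P x', ν)
      = (((tower P a 0).G P.K * (deriv P 0 P.eps ν)ᵀ) x x' : ℂ) := by
  rw [Matrix.mul_apply, Matrix.mul_apply, ← (eFine P).sum_comp]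
  push_cast
  refine Finset.sum_congr rfl fun x'' _ => ?_
  rw [Gp_bridge P ha hK, Matrix.conjTranspose_apply, Matrix.transpose_apply, GradOp_bridge, Complex.star_def, Complex.conj_ofReal]

end Summit.QuantumFields.BalabanUV.Beta.FP.ScalarTowerBridge

end
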